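import Summits.NavierStokesRegularity.NavierStokesRegularity.Theorems.DssFarFieldSlavingBlowupTypeIDssProfileClassToProfile
import HarnessLib

/-!
# Syndetic returns of the powers of a linear isometry; the class-level form of a fixed-twist
  removal statement (route `DssFarFieldSlaving`, crux `BlowupTypeIDssProfile`,
  stmt-NavierStokesRegularity-0155 — SUPPORT; cell pub-ns-dss, theory item T13 / lead X-b∞)

For a rotated `c`-DSS profile with a twist `R` of INFINITE order neither Chae–Wolf 2017 Thm 1.3
(`R = 1`) nor Pineau–Vicol 2026 Thm 1.7 (twist angle `→ 0` in both corners) applies as typed.  The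
cell's target X-b∞ (`RemovingRdssFixedTwist`, HOME/theory/LANE-X.md) is Chae–Wolf's compactness
argument for a FIXED twist `R`, whose one non-PDE input is recurrence of the powers `Rⁿ` to the
identity with bounded gaps.  This file lands that input and the class-level bridge:

* `syndeticReturns` (theory seat, sketch v1.4 §5a′, proved there; generalised here from `ℝ³` to any
  finite-dimensional real normed space): for a linear isometry `R` and `ε > 0` there is a gap `g`
  such that every window `[n₀, n₀ + g]` contains `n` with `‖R^{n+1} x − x‖ ≤ ε‖x‖` for all `x`
  (compact-group recurrence: a finite `ε`-net of the bounded orbit `{Rᵏ}` in operator norm).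
* `rdssClass_removing_fixedTwist_of_classical`: the classical fixed-twist removal statement at
  `(C₀, R, c₁)` — every classical rotated `c`-DSS Type-I(`C₀`) solution on the past with twist `R`
  and `1 < c < c₁` vanishes — implies the same for the duality-form class at the same constant
  (through `rdssClass_classicalRepresentative`).  The classical statement itself is OPEN (to be
  filed as an item by the planner); nothing here asserts it.

## References

* D. Chae, J. Wolf, Comm. PDE 42 (2017) = arXiv:1610.09464, Thm 1.3 and §3. [ChaeWolf2017RemovingDSS]
* B. Pineau, V. Vicol, arXiv:2607.09619 (2026), Thm 1.7. [PineauVicol2026]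
-/

set_option linter.dupNamespace false

noncomputable section

namespace Summit.NavierStokesRegularity.NavierStokesRegularity.Theorems

open MeasureTheory Set Function Filter Metric Literature.Analysis.FluidPDE

/-- **Syndetic returns of the powers of a linear isometry to the identity** (compact-group
recurrence; theory seat, sketch v1.4 §5a′): for every linear isometry `R` of a finite-dimensional
real normed space and every `ε > 0` there is `g` such that for every `n₀` some `n ∈ [n₀, n₀ + g]` has
`‖R^{n+1} x − x‖ ≤ ε ‖x‖` for all `x`.  Proof: the orbit `{Rᵏ}` is bounded in the finite-dimensional
operator space, hence totally bounded; take a finite `ε`-net by orbit points `R^{k_j}`, `k_j ≤ K`;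
`R^{n₀+K+1}` is `ε`-close to some `R^{k_j}`, and `R^{k_j}` being an isometry, `R^{n₀+K+1−k_j}` is
`ε`-close to the identity. [folklore] -/
theorem syndeticReturns {E : Type*} [NormedAddCommGroup E] [NormedSpace ℝ E] [FiniteDimensional ℝ E]
    (R : E ≃ₗᵢ[ℝ] E) {ε : ℝ} (hε : 0 < ε) :
    ∃ g : ℕ, ∀ n₀ : ℕ, ∃ n : ℕ, n₀ ≤ n ∧ n ≤ n₀ + g ∧ ∀ x : E, ‖(R ^ (n + 1)) x - x‖ ≤ ε * ‖x‖ := by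
  haveI : FiniteDimensional ℝ (E →L[ℝ] E) := ContinuousLinearMap.finiteDimensional
  set f : ℕ → (E →L[ℝ] E) := fun k => (R ^ k).toLinearIsometry.toContinuousLinearMap with hf
  have hbdd : Bornology.IsBounded (Set.range f) := by
    refine (Metric.isBounded_iff_subset_closedBall (0 : E →L[ℝ] E)).2 ⟨1, ?_⟩
    rintro _ ⟨k, rfl⟩
    exact mem_closedBall_zero_iff.2 (R ^ k).toLinearIsometry.norm_toContinuousLinearMap_le
  have htb : TotallyBounded (Set.range f) :=
    TotallyBounded.subset subset_closure hbdd.isCompact_closure.totallyBounded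
  obtain ⟨t, hts, htfin, hcover⟩ := Metric.finite_approx_of_totallyBounded htb ε hε
  have hidx : ∀ y ∈ t, ∃ k, f k = y := fun y hy => hts hy
  choose! idx hidx using hidx
  set K : ℕ := htfin.toFinset.sup idx with hK
  refine ⟨K, fun n₀ => ?_⟩
  have hm : f (n₀ + K + 1) ∈ ⋃ y ∈ t, Metric.ball y ε := hcover ⟨_, rfl⟩
  obtain ⟨y, hy, hdist⟩ := Set.mem_iUnion₂.1 hm
  have hk : idx y ≤ K := by
    rw [hK]; exact Finset.le_sup (htfin.mem_toFinset.2 hy)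
  refine ⟨n₀ + K - idx y, by omega, by omega, fun x => ?_⟩
  have hnorm : ‖f (n₀ + K + 1) - f (idx y)‖ ≤ ε := by
    rw [hidx y hy, ← dist_eq_norm]; exact (Metric.mem_ball.1 hdist).le
  have h2 : ‖(f (n₀ + K + 1) - f (idx y)) x‖ ≤ ε * ‖x‖ :=
    (ContinuousLinearMap.le_opNorm _ _).trans (mul_le_mul_of_nonneg_right hnorm (norm_nonneg _))
  have hsplit : R ^ (n₀ + K + 1) = R ^ (idx y) * R ^ (n₀ + K - idx y + 1) := by
    rw [← pow_add]; congr 1; omega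
  change ‖(R ^ (n₀ + K + 1)) x - (R ^ (idx y)) x‖ ≤ ε * ‖x‖ at h2
  rw [hsplit, LinearIsometryEquiv.coe_mul, Function.comp_apply, ← map_sub,
    LinearIsometryEquiv.norm_map] at h2
  exact h2

/-- **Class-level form of a fixed-twist removal statement** (cell X-b∞): if every CLASSICAL rotated
`c`-DSS solution on `ℝ³ × (−∞,0)` with twist `R`, factor `1 < c < c₁` and Type-I constant `C₀`
vanishes identically, then every member of the duality-form class (ancient mild `ν = 1`, measurable
slices, rotated `c`-DSS for `R`, Type-I(`C₀`)) with `1 < c < c₁` is a.e. zero on every slice — via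
the classical representative at the same `(c, R, C₀)` (`rdssClass_classicalRepresentative`).  The
hypothesis is an OPEN statement for twists of infinite order; this is only the bridge.
[cite: ChaeWolf2017RemovingDSS, Theorem 1.3] -/
theorem rdssClass_removing_fixedTwist_of_classical {C₀ c₁ : ℝ}
    {R : EuclideanSpace ℝ (Fin 3) ≃ₗᵢ[ℝ] EuclideanSpace ℝ (Fin 3)}
    (H : ∀ c : ℝ, 1 < c → c < c₁ →
      ∀ (u : ℝ → EuclideanSpace ℝ (Fin 3) → EuclideanSpace ℝ (Fin 3)) (p : ℝ → EuclideanSpace ℝ (Fin 3) → ℝ),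
        IsClassicalNSSolutionOn (Iio 0) 1 0 u p → IsRotatedDSS c R u → HasTypeIDecay C₀ u →
        ∀ t < 0, ∀ x, u t x = 0) :
    ∀ c : ℝ, 1 < c → c < c₁ → ∀ (u : ℝ → EuclideanSpace ℝ (Fin 3) → EuclideanSpace ℝ (Fin 3)),
      IsAncientMildSolution 1 u → (∀ t < 0, AEStronglyMeasurable (u t) volume) →
      IsRotatedDSS c R u → HasTypeIDecay C₀ u → ∀ t < 0, u t =ᵐ[volume] 0 := by
  intro c hc hlt u hu hmeas hdss hC t ht
  obtain ⟨V, P, -, hP, hR, hdec, hVu, -⟩ := rdssClass_classicalRepresentative hc hu hmeas hdss hC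
  have hV0 : V t = 0 := funext fun x => H c hc hlt V P hP hR hdec t ht x
  have key := hVu t ht
  rw [hV0] at key
  exact key.symm

end Summit.NavierStokesRegularity.NavierStokesRegularity.Theorems

end
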